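import Mathlib
import HarnessLib
import Literature.MathematicalPhysics.StatisticalMechanics.LastScaleKernelSecondDiffTorusFRD

/-!
# The FULL `ℓ = 2` slot of the last integration step along a LINE of tuning parameters, uniformly in `N`:
# `‖Φ(q+2h) − 2Φ(q+h) + Φ(q)‖ ≤ [second-order part] + 2·[first-order part]`, `Φ(q) = ∫ y(Λ) dμ^{(q)}_{N+1}`
# ([ABKM19] Lemma 8.4 / Lemma 12.6 with `ℓ = 2`, last scale)

Assembly of the two halves of the second difference of the last-scale functional along `q, q+h, q+2h`:
`Φ(q+2h) − 2Φ(q+h) + Φ(q) = [Φ(q+2h) − 2Φ̄ + Φ(q)] + 2[Φ̄ − Φ(q+h)]`, `Φ̄ = ∫ y(Λ) dN(0, ½(𝒞_{1+q} + 𝒞_{1+q+2h}))`: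
the genuine second-order part `norm_integral_last_kernel_secondDiff_le_of_torusFRD` (price
`27 q_H² (3^{(d+1)/2} T e^{2KT} K)²`, `T = Σ|2h|`) and the first-order part
`norm_integral_last_kernel_mid_sub_le_of_torusFRD` (price `8 q_H 3^{(d+1)/2} ½(Σ|h|)² K⁽²⁾`).  Both are quadratic
in `h` and independent of `N`; the parallelogram form (F4Φ22) follows by `ParallelogramSecondDiff` (not here).

* **`norm_integral_last_kernel_lineSecondDiff_le_of_torusFRD`**.

## References
* S. Adams, S. Buchholz, R. Kotecký, S. Müller, arXiv:1910.13564, Lemma 8.4, (12.15), Lemma 12.6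
  [AdamsBuchholzKoteckyMuller2019].
* S. Buchholz, J. Funct. Anal. 275 (2018), Thm 4.5 [Buchholz2016].
-/

noncomputable section

namespace Literature.MathematicalPhysics.StatisticalMechanics.GradientRG

open scoped BigOperators Classical
open Real Finset MeasureTheory
open Literature.MathematicalPhysics.StatisticalMechanics.GradientFRD
  (fourierCoeff cExt cExt_of_mem IsElliptic IsUnitSymm InShell iterDiff supNorm conv ellOp isElliptic_one)
open Literature.MathematicalPhysics.StatisticalMechanics.TorusPolymer (IsPolymer numBlocks isPolymer_univ)
open Literature.Barriers.CriticalPhenomena.LongRangePhi4.Polymer (IsConn)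
open Literature.MathematicalPhysics.QuantumFieldTheory

variable {d M : ℕ} [NeZero M]

section Package

variable {L N Mord R n ñ : ℕ} {θbar lam μ δ₁ δ₀ A𝒫 : ℝ}
    {𝒞 : Matrix (Fin d) (Fin d) ℝ → ℕ → (Fin d → ZMod M) → ℝ} {Mc : ℕ → ℝ}
    {Cα : (Fin d → ℕ) → ℕ → ℝ} {c C : ℝ} {Cℓ : ℕ → ℝ}

set_option maxHeartbeats 1600000 in
/-- **The full `ℓ = 2` slot of the last integration step along a line, uniformly in `N`**: for one `TorusFRD`
package with the gap `d + 1 ≤ 2(ñ−n)`, symmetric `q, h` with `q, q+h, q+2h` in the ball `Σ|·| ≤ T₀ ≤ ½`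
(`K T₀ ≤ log(1+ρ)`, `ρ < θ̄`), Hölder conjugates `p, q_H` with `p(1+ρ) ≤ 1+ρ''` (`ρ'' < θ̄`), and `y` with
`‖y‖_N^{(A)} ≤ c_y`, `C^{r₀}`, `T_N^{Λ*}`-local:
`‖Φ(q+2h) − 2Φ(q+h) + Φ(q)‖ ≤ [27 q_H² (3^{(d+1)/2} T e^{2KT} K)²-term] + 2·[8 q_H 3^{(d+1)/2} ½(Σ|h|)² K⁽²⁾-term]`
(`T = Σ|2h|`), both `∝ c_y A⁻¹ (r₀+1) κ` — no dependence on `N`.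
[cite: AdamsBuchholzKoteckyMuller2019, Lemma 8.4 / (12.15) / Lemma 12.6] -/
theorem norm_integral_last_kernel_lineSecondDiff_le_of_torusFRD
    (hd : 3 ≤ d) (hMord : 1 ≤ Mord) (hMR : Mord ≤ R) (hLodd : Odd L) (hL : 2 ^ (d + 3) + 16 * R ≤ L)
    (hM : M = L ^ N)
    (hθbar : 0 < θbar) (hlam : 0 < lam) (hn : 2 * Mord ≤ n) (hn2 : 2 ≤ n) (hnñ : n ≤ ñ)
    (hgap : d + 1 ≤ 2 * (ñ - n))
    (hc : 0 < c) (hC1 : 0 ≤ Cℓ 1) (hC2 : 0 ≤ Cℓ 2)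
    (hallA : ∀ A : Matrix (Fin d) (Fin d) ℝ, IsElliptic (1 / 2 : ℝ) 2 A →
        (∀ k, 1 ≤ k → k ≤ N + 1 →
          ∑ x : Fin d → ZMod M, 𝒞 A k x = 0 ∧ ∀ x, 𝒞 A k (-x) = 𝒞 A k x) ∧
        (∀ k, 1 ≤ k → k ≤ N + 1 → ∀ φ : (Fin d → ZMod M) → ℝ, ∑ x, φ x = 0 →
          0 ≤ ∑ x, ∑ y, φ x * 𝒞 A k (x - y) * φ y) ∧
        (∀ φ : (Fin d → ZMod M) → ℝ, ∑ x, φ x = 0 →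
          ellOp A (conv (fun x => ∑ k ∈ Finset.Icc 1 (N + 1), 𝒞 A k x) φ) = φ) ∧
        (∀ k, 1 ≤ k → k ≤ N → Mc k ≤ 0 ∧
          ∀ x : Fin d → ZMod M, ((L : ℝ) ^ k) / 2 ≤ (supNorm x : ℝ) →
            𝒞 A k x = Mc k) ∧
        (∀ k, 1 ≤ k → k ≤ N + 1 → ∀ B : Matrix (Fin d) (Fin d) ℝ, IsUnitSymm B →
          (∃ ε : ℝ, 0 < ε ∧ ∀ x : Fin d → ZMod M,
            ContDiffOn ℝ ⊤ (fun s : ℝ => 𝒞 (A + s • B) k x) (Set.Ioo (-ε) ε)) ∧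
          ∀ α : Fin d → ℕ, ∑ i, α i ≤ n → ∀ ℓ : ℕ, ∀ x : Fin d → ZMod M,
            abs (iteratedDeriv ℓ (fun s : ℝ => iterDiff α (𝒞 (A + s • B) k) x) 0)
              ≤ Cα α ℓ / (L : ℝ) ^ ((k - 1) * (d - 2 + ∑ i, α i))) ∧
        (∀ k, 1 ≤ k → k ≤ N + 1 → ∀ j : ℕ, ∀ κ : Fin d → ZMod M, κ ≠ 0 → InShell L j κ →
          (j < k →
            c / (L : ℝ) ^ (2 * (d + ñ) + 1) * (L : ℝ) ^ (2 * j)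
                / (L : ℝ) ^ ((k - j) * (d - 1 + n)) ≤ (fourierCoeff (𝒞 A k) κ).re ∧
            ‖fourierCoeff (𝒞 A k) κ‖
              ≤ C * (L : ℝ) ^ (2 * (d + ñ) + 1) * (L : ℝ) ^ (2 * j)
                  / (L : ℝ) ^ ((k - j) * (d - 1 + n))) ∧
          (k ≤ j →
            c / (L : ℝ) ^ (2 * (d + ñ) + 1) * (L : ℝ) ^ (2 * k)
                ≤ (fourierCoeff (𝒞 A k) κ).re ∧
            ‖fourierCoeff (𝒞 A k) κ‖ ≤ C * (L : ℝ) ^ (2 * k)) ∧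
          ∀ B : Matrix (Fin d) (Fin d) ℝ, IsUnitSymm B → ∀ ℓ : ℕ, 1 ≤ ℓ →
            (j < k →
              ‖iteratedDeriv ℓ (fun s : ℝ => fourierCoeff (𝒞 (A + s • B) k) κ) 0‖
                ≤ Cℓ ℓ * (L : ℝ) ^ (2 * (d + ñ) + 1) * (L : ℝ) ^ (2 * j)
                    / (L : ℝ) ^ ((k - j) * (d - 1 + ñ))) ∧
            (k ≤ j →
              ‖iteratedDeriv ℓ (fun s : ℝ => fourierCoeff (𝒞 (A + s • B) k) κ) 0‖
                ≤ Cℓ ℓ * (L : ℝ) ^ (2 * k))))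
    (hB : AbkmWeightBounds L N Mord R n θbar lam μ δ₁ δ₀ A𝒫 (fun j => 𝒞 1 j)
      (abkmWeightData L N Mord R θbar (schedDelta δ₀ δ₁ N) fun j => 𝒞 1 j))
    {ρ : ℝ} (hρ0 : 0 ≤ ρ) (hρ : ρ < θbar)
    {T₀ : ℝ} (hT₀ : T₀ ≤ 1 / 2) (hKT₀ : shellRatioConst c (Cℓ 1) (L : ℝ) d ñ * T₀ ≤ Real.log (1 + ρ))
    {q yq : Matrix (Fin d) (Fin d) ℝ} (hq : q.IsSymm) (hh : yq.IsSymm)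
    (hqT : ∑ i, ∑ j, |q i j| ≤ T₀) (hqhT : ∑ i, ∑ j, |(q + yq) i j| ≤ T₀)
    (hq2hT : ∑ i, ∑ j, |(q + (2 : ℝ) • yq) i j| ≤ T₀)
    {p qH ρ'' : ℝ} (hpq : p.HolderConjugate qH) (hρ''0 : 0 ≤ ρ'') (hρ'' : ρ'' < θbar)
    (hpρ : p * (1 + ρ) ≤ 1 + ρ'')
    {pT r₀ : ℕ} {h A : ℝ} (hA : 0 < A)
    {y : Finset (Fin d → ZMod M) → ((Fin d → ZMod M) → ℝ) → ℂ} {cy : ℝ} (hcy : 0 ≤ cy)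
    (hy : WeakNormLE (abkmNormParams L N Mord R pT r₀ h θbar A (schedDelta δ₀ δ₁ N) fun j => 𝒞 1 j) N y cy)
    (hyd : ContDiff ℝ r₀ (y univ))
    (hyloc : IsGaugeLocal ((abkmNormParams L N Mord R pT r₀ h θbar A (schedDelta δ₀ δ₁ N) fun j => 𝒞 1 j).gauge N univ)
      (y univ)) :
    ‖(∫ φ, y univ φ ∂(stepMeasure (𝒞 ((1 : Matrix (Fin d) (Fin d) ℝ) + (q + (2 : ℝ) • yq)) (N + 1)))) -
        (2 : ℝ) • (∫ φ, y univ φ ∂(stepMeasure (𝒞 ((1 : Matrix (Fin d) (Fin d) ℝ) + (q + yq)) (N + 1)))) +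
        ∫ φ, y univ φ ∂(stepMeasure (𝒞 ((1 : Matrix (Fin d) (Fin d) ℝ) + q) (N + 1)))‖ ≤
      cy * A⁻¹ * ((r₀ + 1) * (27 * qH ^ 2 *
          (Real.sqrt ((3 : ℝ) ^ (d + 1)) *
            ((∑ i, ∑ j, |((2 : ℝ) • yq) i j|) *
              Real.exp (2 * shellRatioConst c (Cℓ 1) (L : ℝ) d ñ * ∑ i, ∑ j, |((2 : ℝ) • yq) i j|) *
              shellRatioConst c (Cℓ 1) (L : ℝ) d ñ)) ^ 2)) *
        weightIntConstRho θbar ρ'' (traceConst d Mord R lam (derivSum d n fun θ' _ => Cα θ' 0)) ^ (1 / p) +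
      2 * (cy * A⁻¹ * ((r₀ + 1) * (8 * qH *
          (Real.sqrt ((3 : ℝ) ^ (d + 1)) *
            (2⁻¹ * (∑ i, ∑ j, |yq i j|) ^ 2 * shellRatioConst c (Cℓ 2) (L : ℝ) d ñ)))) *
        weightIntConstRho θbar ρ'' (traceConst d Mord R lam (derivSum d n fun θ' _ => Cα θ' 0)) ^ (1 / p)) := by
  have hq2h : (q + (2 : ℝ) • yq).IsSymm := hq.add (hh.smul _)
  have h2 := norm_integral_last_kernel_secondDiff_le_of_torusFRD hd hMord hMR hLodd hL hM hθbar hlam hn hn2 hnñ hgap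
    hc hC1 hallA hB hρ0 hρ hT₀ hKT₀ hq hq2h hqT hq2hT hpq hρ''0 hρ'' hpρ hA hcy hy hyd hyloc
    (pT := pT) (r₀ := r₀) (h := h)
  rw [add_sub_cancel_left] at h2
  have h1 := norm_integral_last_kernel_mid_sub_le_of_torusFRD hd hMord hMR hLodd hL hM hθbar hlam hn hn2 hnñ hgap
    hc hC1 hC2 hallA hB hρ0 hρ hT₀ hKT₀ hq hh hqT hqhT hq2hT hpq hρ''0 hρ'' hpρ hA hcy hy hyd hyloc
    (pT := pT) (r₀ := r₀) (h := h)
  -- `Φ₂ − 2Φ₁ + Φ₀ = (Φ₂ − 2Φ̄ + Φ₀) + 2(Φ̄ − Φ₁)`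
  set Φ₂ := ∫ φ, y univ φ ∂(stepMeasure (𝒞 ((1 : Matrix (Fin d) (Fin d) ℝ) + (q + (2 : ℝ) • yq)) (N + 1)))
    with hΦ₂
  set Φ₁ := ∫ φ, y univ φ ∂(stepMeasure (𝒞 ((1 : Matrix (Fin d) (Fin d) ℝ) + (q + yq)) (N + 1))) with hΦ₁
  set Φ₀ := ∫ φ, y univ φ ∂(stepMeasure (𝒞 ((1 : Matrix (Fin d) (Fin d) ℝ) + q) (N + 1))) with hΦ₀
  set Φm := ∫ φ, y univ φ ∂(stepMeasure (fun x => 2⁻¹ * 𝒞 ((1 : Matrix (Fin d) (Fin d) ℝ) + q) (N + 1) x +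
    2⁻¹ * 𝒞 ((1 : Matrix (Fin d) (Fin d) ℝ) + (q + (2 : ℝ) • yq)) (N + 1) x)) with hΦm
  have hsplit : Φ₂ - (2 : ℝ) • Φ₁ + Φ₀ = (Φ₂ - (2 : ℝ) • Φm + Φ₀) + (2 : ℝ) • (Φm - Φ₁) := by
    rw [smul_sub]; abel
  calc ‖Φ₂ - (2 : ℝ) • Φ₁ + Φ₀‖ = ‖(Φ₂ - (2 : ℝ) • Φm + Φ₀) + (2 : ℝ) • (Φm - Φ₁)‖ := by rw [hsplit]
    _ ≤ ‖Φ₂ - (2 : ℝ) • Φm + Φ₀‖ + ‖(2 : ℝ) • (Φm - Φ₁)‖ := norm_add_le _ _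
    _ = ‖Φ₂ - (2 : ℝ) • Φm + Φ₀‖ + 2 * ‖Φm - Φ₁‖ := by
        rw [norm_smul, Real.norm_eq_abs, abs_of_pos (by norm_num : (0 : ℝ) < 2)]
    _ ≤ _ := add_le_add h2 (mul_le_mul_of_nonneg_left h1 (by norm_num))

end Package

end Literature.MathematicalPhysics.StatisticalMechanics.GradientRG

end
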